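import Summits.QuantumFields.YangMills.Theorems.BalabanUVNodesN11Sect3SupplyChainBorelBThm1PrintedOfBgFacts
import Summits.QuantumFields.YangMills.Theorems.BalabanUVNodesN11K1CeilingFreeOfSupplyChain

/-!
# DAG node N11 — THE NODE FACES OF THE SupplierBorel ∕ bg-FACTS ROAD: N11's DAG node `Dag.B14_main (leavesP w P)` (per run ∕ ∀ runs) at ANY world bound to the
# CoPH datum of a Gaussian-class `θ`, the thirteen-nodes ceiling transfer, and the `h11`-shaped (S1ᵀ) family of the K1-by-name road — from this
# seat's guard-free token `SupplyChainAt θ p` (H3, bg facts displayed) through dag-n11-d's window-threaded node face; NO `PartCompat₁₃`, NO (2.6), NO member numerics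

HEADER — WORK-UNIT METADATA.  Cell `pub-ymgap`, YM-PLAN Track A (HUMAN RULING D-0062 ∕ D-0149 width seats), seat `pub-ymgap-dag-n11-w1` (g4; WIDTH SEAT 1 of 4 on NODE
n11 [B14]), route `BalabanUVNodes` rev 29, KEY item K1⁹ `StabilityBRunRowsAtRecordR13SepCoPHV` = stmt-QuantumFields-27364 (dag-lead KEY MAP v2; helper lane, `--kind proof
--supports 27364 --as helper`, count-neutral; seat payload key K1⁷ 20542 = MIS-KEY fallback).  [III] = [Balaban1988Convergent], [V] = [Balaban1989LargeFieldII], [IV] =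
[Balaban1989LargeFieldI], [15] = [Balaban1985Variational].  Over this seat's H3 `…Sect3SupplyChainBorelBOfBgFacts` (p626869:
`supplyChainAt_of_gaussCert_of_supplierBorel_of_bgFacts_of_powM` — N11's one-token residual at any Gaussian-class `θ` WITHOUT the run guard, the bg facts of the run displayed),
H5 `…Sect3SupplyChainBorelBThm1PrintedOfBgFacts` (p627901: the window transfer `step_inInterval_top_of_flow_inInterval_min`, the named certificate `gaussPinH`), dag-n11-d g14
`…N11K1CeilingFreeOfSupplyChain` (p609050: `b14_main_leavesP_of_supplyChainAt_of_window`, `nodes_leavesP_withCeiling_of_b14_main`), dag-n11-e `…Sect3SupplyChainObligationsDefs`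
(`thmP245Laws_of_supplyChainAt`).

WHY THIS FILE.  The BorelB road's outputs of record are the per-run TOKEN `SupplyChainAt θ p` (H3) and N11's PRINTED face `B16.Thm1Printed` at the datum (H5); the K1
assembly READS neither: K1⁹ v9 LINE 1 `stub_nodes13PWS` asks the N11 CONJUNCT `Dag.B14_main (leavesP w P)` of `Nodes (leavesP w P)` at an S-bound world of the datum for EVERY
run, and dag-n24-c's K1⁹-by-name road asks the `h11`-SHAPED family (the (S1ᵀ) slot over every world bound to the datum with prescribed `(βup, β₀)` and small `γ`, under the
node's own leaf antecedents).  dag-n11-w4 g0's `…N11NodeFacesOfCoercive` typed that layer for the coercive ∕ splice-supply road; THIS FILE types it for the SupplierBorel ∕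
bg-facts road: (§1) per run, N11's node at ANY world `w` with `w.C = (datumOfRecord₁₃CoPH θ h).C`, `w.γ ≤ θ.γ` — the chain asked only on the world's own window (dag-n11-d's
threading through `smallCouplings`), moved to the Step window of the record's couplings (`(w.C P).flow.g = gOfRecord₁₃ θ P`, `rfl`); (§2) ∀ runs at a world with
`w.γ ≤ min γ θ.γ`, rows keyed on `]0, γ]` exactly as in H5: the node and the thirteen-nodes CEILING TRANSFER (dag-n11-d g14 §1 ★★ with `hN` DISCHARGED);
(§3) the `h11`-shaped family at the SepCoPH datum, `γ₁₁ := min γ θ.γ` (`βup ∕ β₀ ∕ b7…b11 ∕ smallFieldInductive ∕ flowControl` UNREAD); (§4) the editions at the NAMED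
certificate `gaussPinH θ` (no class hypothesis: `gaussPinH_ζ0 ∕ gaussPinH_quad` `rfl`; key by `provisos₁₃SepCoPH_gaussPinH`).

WHAT THIS FILE PROVES (6 theorems, 0 `def`, 0 `sorry`; standard axioms; compositions BY NAME).
§1 ★ `b14_main_leavesP_of_gaussCert_of_supplierBorel_of_bgFacts_of_powM` (per run).
§2 ★★ `b14_main_leavesP_all_of_gaussCert_of_supplierBorel_of_bgFacts_of_powM` · ★★ `nodes_leavesP_withCeiling_of_gaussCert_of_supplierBorel_of_bgFacts_of_powM`.
§3 ★★★ `h11Family_of_gaussCert_of_supplierBorel_of_bgFacts_of_powM`.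
§4 ★★ `b14_main_leavesP_all_gaussPinH_of_supplierBorel_of_bgFacts_of_powM` · ★★★ `h11Family_gaussPinH_of_supplierBorel_of_bgFacts_of_powM`.

HONEST FRAMING.  Helper lane of K1⁹; count-neutral KERNEL COMPOSITION of landed theorems; every analytic row is a DISPLAYED HYPOTHESIS exactly as in H3 ∕ H5: the Gaussian
certificate class `hζ ∕ hq` (none at `gaussPinH θ`), the live-selector line, admissibility, `0 ≤ κ ∕ E₀ ∕ B₀`, `0 < M₁ ≤ M`, `2 ≤ cR` (UNINHABITED at the witnesses of record
`cR := 1`; live only at a cR-lettered member, dag-n11-w3 g4), `L·M₂ ∣ M`, `M = L^a`, and per windowed run the bg facts `∀ k ≤ K, BgProvisoΛ …` ([III] (2.28) ∕ [15] Thm 1 content;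
producers dag-n11-w4 p624439 ∕ dag-n11-w5 p623895 ∕ p626404 at H-extensions of K1's witness), the five numeric rows, K0's per-cube [15]-solvability and [III] §3's supplier with
`SupplierObligations ∧ SupplierBorel` (= Thm 2 proper — nobody's theorem).  Nothing of Bałaban asserted; no statement about which `θ` carries the rows; no v9 stub touched; K1⁹ NOT
closed; N11 NOT discharged; counts unmoved (typed 28∕28 · discharged 5∕27 · A 5∕28).  One finite `𝕋⁴_{L^K}` programme at fixed `ε = L^{−K}`; R4 closes only the conditional
finite-𝕋⁴ rung `BalabanLadder.UV` — NOT ℝ⁴, NOT OS, NOT a mass gap, NOT Clay.  No `sorry`, no `axiom`, no `def`, no `instance`, no `notation`.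
Sources (SHAPE ∕ bookkeeping only): [III] Thm 1 p.262, Theorem p.245, p.244 L36–38, §3 p.279, (2.6) p.255, (2.28) p.259, p.257, (3.16) p.268, (3.24)–(3.25) p.270; [V] Thm 1 +
(0.1) pp.355–356 (the citation DAG); [IV] (0.3)–(0.4) p.176, p.177 (i)–(ii); [15] Thm 1 (7)–(8) pp.278–279.
-/

noncomputable section

open MeasureTheory
open scoped BigOperators ENNReal NNReal Matrix.Norms.L2Operator

namespace Summit.QuantumFields.YangMills.Theorems.BalabanUVNodesN11NodeFacesOfSupplierBorelOfBgFacts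

open Literature.MathematicalPhysics.QuantumFieldTheory.Balaban1983to89 T4Continuum T4NestedCovariance Node00 Node00.Tk DagBinding
open B15DeterminingSets B8Eq17ClassAkV1 B14.Eq218Concrete B10Eq42TorusConstraint Step
open B14.Eq213MaximalDomains (side)
open B14.Eq213DetSet (Bj)
open Literature.MathematicalPhysics.QuantumFieldTheory.BalabanImbrieJaffe1984to88.BIJ85Eq453GaugeField (qsstarGIter0)
open Summit.QuantumFields.YangMills.Theorems.StabilityBAtRecordR13SepCoPH.Negative.SignBoxAtEveryWitnessFalse (withCeiling)
open BalabanUVNodesN11HistoryPinnedResidualDefs BalabanUVNodesN11RePinnedParamDefs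
open BalabanUVNodesN11GaussianCertificateDefs (gaussPinH gaussPinH_ζ0 gaussPinH_quad provisos₁₃CoPH_gaussPinH)
open BalabanUVNodesN11Sect3SupplyChainDefs
open BalabanUVNodesN11Sect3SupplyChainBorelB
open BalabanUVNodesN11Sect3SupplyChainObligationsDefs
open BalabanUVNodesN11Sect3SupplyChainBorelBThm1PrintedOfSolvable (provisos₁₃SepCoPH_gaussPinH step_inInterval_top_of_flow_inInterval_min)
open BalabanUVNodesN11Sect3SupplyChainBorelBOfBgFacts (supplyChainAt_of_gaussCert_of_supplierBorel_of_bgFacts_of_powM)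
open BalabanUVNodesN11K1CeilingFreeOfSupplyChain (b14_main_leavesP_of_supplyChainAt_of_window nodes_leavesP_withCeiling_of_b14_main)

variable {F : T4Family} {N : ℕ} [NeZero N]

/-! ## §1  Per run: N11's DAG node at any world bound to the CoPH datum of a Gaussian-class `θ`, window `w.γ ≤ θ.γ` -/

section PerRun

variable (θ : Stage13HParams F N) (p : B12.RunParams)

/-- **★ N11's DAG NODE `Dag.B14_main (leavesP w p)` ON THE SupplierBorel ∕ bg-FACTS ROAD, PER RUN** — at ANY world `w` whose construction is the CoPH datum of a
Gaussian-class `θ` (`w.C = (datumOfRecord₁₃CoPH θ h).C`) and whose coupling radius does not exceed the record's (`w.γ ≤ θ.γ`): dag-n11-d's window-threaded node face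
`b14_main_leavesP_of_supplyChainAt_of_window` with its chain binder `hN : window → SupplyChainAt θ p` DISCHARGED by this seat's guard-free token (H3
`supplyChainAt_of_gaussCert_of_supplierBorel_of_bgFacts_of_powM`); the node's `smallCouplings` antecedent IS the Step window of the record's couplings along `p` (`rfl`), whence the
token's `hw`.  Displayed for the run: the bg facts `hbgs` at every level `≤ K`, `L·M₂ ∣ M`, `M = L^a`, the five numeric rows, K0's per-cube [15]-solvability, [III] §3's supplier
`σ` with `SupplierObligations ∧ SupplierBorel`; θ-level: the certificate, the live-selector line, admissibility, signs, `0 < M₁ ≤ M`, `2 ≤ cR`.  NO `PartCompat₁₃`; `βup ∕ β₀ ∕ b ∕ gR ∕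
up` UNREAD. [cite: Balaban1988Convergent, Thm 1 p.262, Theorem p.245, p.244 L36–38, §3 p.279, (2.28) p.259, p.257, (3.24)–(3.25) p.270; Balaban1989LargeFieldII, Introduction pp.355–356; Balaban1989LargeFieldI, (0.3)–(0.4) p.176, p.177 (i)–(ii); Balaban1985Variational, Thm 1 (7)–(8) pp.278–279] -/
theorem b14_main_leavesP_of_gaussCert_of_supplierBorel_of_bgFacts_of_powM
    (hζ : ∀ (p' : B12.RunParams) (n : ℕ) (Ω Λ : ℕ → Set (Site (F.P p'.K) 0)), (θ.Zh p' n Ω Λ).ζ0 = (ZhPinOfRecord₁₃ θ.toStage13Params p' Ω Λ).ζ0)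
    (hq : ∀ (p' : B12.RunParams) (n : ℕ) (Ω Λ : ℕ → Set (Site (F.P p'.K) 0)) (j : ℕ) (Λ' : Set (Site (F.P p'.K) 0)) (ω : MultiCfg (F.P p'.K) (SU N) (FluctV N)),
      (θ.Zh p' n Ω Λ).quad j Λ' ω = ∑ b ∈ (Set.toFinite (bondsIn j (Λ'ᶜ ∩ Ω (j + 1)))).toFinset, ‖(ω j).2 b‖ ^ 2)
    (h : θ.Provisos₁₃CoPH F N) (hsel : θ.ppSel = ppSelLiveOfRecord F N θ.ν θ.τ9 (EOfRecord₁₃ F N θ.toStage13Params) (wOfRecord₉ F N θ.toStage9Params))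
    (hθ : θ.Admissible F N) (hκ : 0 ≤ θ.s2.lf.κ) (hE₀ : 0 ≤ θ.s2.lf.E₀) (hB₀ : 0 ≤ θ.s2.lf.B₀)
    (hM₁ : 0 < θ.ν.M₁) (hle : θ.ν.M₁ ≤ θ.τ9.M) (hcR : 2 ≤ θ.s2.cR)
    (hbgs : ∀ k, k ≤ p.K → BgProvisoΛ F N p.K (settingOfRecord₁₃ F N θ.toStage13Params p) (θ.Rz p.K) θ.τ9.M k (suppOfRecord₁₃SepCoP F N θ.toStage13Params p k)
      (UbgOfRecord₁₃CoP F N θ.toStage13Params p k))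
    (hdiv : F.L * θ.ν.M₂ ∣ θ.τ9.M) {a : ℕ} (hMa : θ.τ9.M = F.L ^ a)
    (h3 : ∀ j, 1 ≤ j → j ≤ p.K →
      3 * side (F.P p.K).L θ.ν.M₁ j ≤ cubeSide (F.P p.K).L θ.ν.M₂ (RkOfRecord (F.P p.K).L θ.ν.r (gOfRecord₁₃ F N θ.toStage13Params p j)) j)
    (hR : ∀ j, 1 ≤ j → j ≤ p.K → (F.P p.K).L ^ j + (((F.P p.K).d + 4) * (F.P p.K).L + 2) * (∑ l ∈ Finset.range j, (F.P p.K).L ^ l) + 2 ≤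
      cubeSide (F.P p.K).L θ.ν.M₂ (RkOfRecord (F.P p.K).L θ.ν.r (gOfRecord₁₃ F N θ.toStage13Params p j)) j)
    (hε : ∀ j, 1 ≤ j → j ≤ p.K → 0 < epsOfRecord θ.ν (gOfRecord₁₃ F N θ.toStage13Params p) j)
    (hε3 : ∀ j, 1 ≤ j → j ≤ p.K → (143 * (((((F.P p.K).d + 4 : ℕ) : ℝ)) ^ 2 / 4) ^ 2) * epsOfRecord θ.ν (gOfRecord₁₃ F N θ.toStage13Params p) j ≤ 1 / 3)
    (hε2 : ∀ j, 1 ≤ j → j ≤ p.K →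
      2 * epsOfRecord θ.ν (gOfRecord₁₃ F N θ.toStage13Params p) j ≤ 2 * ExpMeanLog.deltaSU (Fin N) / ((((F.P p.K).d + 4) * (F.P p.K).L : ℕ) : ℝ) ^ 2)
    (hsolv : ∀ j, 1 ≤ j → j ≤ p.K → ∀ (s : SeqOfRecord F θ.ν θ.τ9.M (gOfRecord₁₃ F N θ.toStage13Params p) p.K j) (V : GaugeField (F.P p.K) j (SU N)),
      chiSeqOfRecord F N θ.ν θ.τ9.M (gOfRecord₁₃ F N θ.toStage13Params p) p.K j s V ≠ 0 →
      ∀ a ∈ cubesIn (fun a : ↥(cubeIndices (F.P p.K) (cubeSide (F.P p.K).L θ.ν.M₂ (RkOfRecord (F.P p.K).L θ.ν.r (gOfRecord₁₃ F N θ.toStage13Params p j)) j)) =>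
          cubeEnl (F.P p.K) (cubeSide (F.P p.K).L θ.ν.M₂ (RkOfRecord (F.P p.K).L θ.ν.r (gOfRecord₁₃ F N θ.toStage13Params p j)) j) a 0) (s.Ω j),
        ∃ U₀, IsMinimizer (avOfRecord F N p.K) {U | PlaqSmall (θ.ν.εreg * (F.P p.K).eta j ^ 2) U}
          (Bj θ.ν.M₁ (cubeEnl (F.P p.K) (cubeSide (F.P p.K).L θ.ν.M₂ (RkOfRecord (F.P p.K).L θ.ν.r (gOfRecord₁₃ F N θ.toStage13Params p j)) j) a 4) j)
          (avgFamily (avOfRecord F N p.K) (qsstarGIter0 j V)) U₀)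
    (σ : Sect3Supplier θ p) (hσ : SupplierObligations θ p σ) (hσB : SupplierBorel θ p σ)
    (w : WorldP) (hC : w.C = (datumOfRecord₁₃CoPH F N θ h).C) (hγw : w.γ ≤ θ.γ) : Dag.B14_main (leavesP w p) :=
  b14_main_leavesP_of_supplyChainAt_of_window h hsel hθ hκ hE₀ hB₀ ((Nat.succ_le_of_lt hM₁).trans hle) w hC fun hw =>
    supplyChainAt_of_gaussCert_of_supplierBorel_of_bgFacts_of_powM θ p hζ hq h hθ hM₁ hle hcR
      (fun j hj => ⟨(hw j hj).1, (hw j hj).2.trans hγw⟩) hbgs hdiv hMa h3 hR hε hε3 hε2 hsolv σ hσ hσB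

end PerRun

/-! ## §2  All runs at a world with `w.γ ≤ min γ θ.γ`: the node and the thirteen-nodes ceiling transfer — rows keyed on the window `]0, γ]` -/

section AllRuns

variable (θ : Stage13HParams F N)

/-- **★★ N11's DAG NODE AT EVERY RUN — `∀ P, Dag.B14_main (leavesP w P)` — ON THE SupplierBorel ∕ bg-FACTS ROAD**, at ANY world `w` bound to the CoPH datum of a
Gaussian-class `θ` with `w.γ ≤ min γ θ.γ`; per windowed run (`Step.InInterval γ P.K (gOfRecord₁₃ θ P)`, exactly H5's binder shapes) the bg facts at every level `≤ K`, the five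
numeric rows, K0's per-cube [15]-solvability and [III] §3's supplier with `SupplierObligations ∧ SupplierBorel`; θ-level rows as in §1.  The node's window `]0, w.γ]` is moved to
`]0, min γ θ.γ]` (`B14Cor3.inInterval_of_le`) and split by H5's `step_inInterval_top_of_flow_inInterval_min`.  This is the N11 CONJUNCT of `Nodes (leavesP w P)` that K1⁹ v9's
`stub_nodes13PWS` reads at its S-bound world — ON THIS ROAD, with every analytic letter displayed; NO `PartCompat₁₃`. [cite: Balaban1988Convergent, Thm 1 p.262, Theorem p.245, p.244 L36–38, §3 p.279, (2.28) p.259, p.257, (3.24)–(3.25) p.270; Balaban1989LargeFieldII, Thm 1 + (0.1) pp.355–356; Balaban1989LargeFieldI, (0.3)–(0.4) p.176, p.177 (i)–(ii); Balaban1985Variational, Thm 1 (7)–(8) pp.278–279] -/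
theorem b14_main_leavesP_all_of_gaussCert_of_supplierBorel_of_bgFacts_of_powM
    (hζ : ∀ (p : B12.RunParams) (n : ℕ) (Ω Λ : ℕ → Set (Site (F.P p.K) 0)), (θ.Zh p n Ω Λ).ζ0 = (ZhPinOfRecord₁₃ θ.toStage13Params p Ω Λ).ζ0)
    (hq : ∀ (p : B12.RunParams) (n : ℕ) (Ω Λ : ℕ → Set (Site (F.P p.K) 0)) (j : ℕ) (Λ' : Set (Site (F.P p.K) 0)) (ω : MultiCfg (F.P p.K) (SU N) (FluctV N)),
      (θ.Zh p n Ω Λ).quad j Λ' ω = ∑ b ∈ (Set.toFinite (bondsIn j (Λ'ᶜ ∩ Ω (j + 1)))).toFinset, ‖(ω j).2 b‖ ^ 2)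
    (h : θ.Provisos₁₃CoPH F N) (hsel : θ.ppSel = ppSelLiveOfRecord F N θ.ν θ.τ9 (EOfRecord₁₃ F N θ.toStage13Params) (wOfRecord₉ F N θ.toStage9Params))
    (hθ : θ.Admissible F N) (hκ : 0 ≤ θ.s2.lf.κ) (hE₀ : 0 ≤ θ.s2.lf.E₀) (hB₀ : 0 ≤ θ.s2.lf.B₀)
    (hM₁ : 0 < θ.ν.M₁) (hle : θ.ν.M₁ ≤ θ.τ9.M) (hcR : 2 ≤ θ.s2.cR) {γ : ℝ}
    (hbgs : ∀ P : B12.RunParams, Step.InInterval γ P.K (gOfRecord₁₃ F N θ.toStage13Params P) → ∀ k, k ≤ P.K →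
      BgProvisoΛ F N P.K (settingOfRecord₁₃ F N θ.toStage13Params P) (θ.Rz P.K) θ.τ9.M k (suppOfRecord₁₃SepCoP F N θ.toStage13Params P k)
        (UbgOfRecord₁₃CoP F N θ.toStage13Params P k))
    (hdiv : F.L * θ.ν.M₂ ∣ θ.τ9.M) {a : ℕ} (hMa : θ.τ9.M = F.L ^ a)
    (h3 : ∀ P : B12.RunParams, Step.InInterval γ P.K (gOfRecord₁₃ F N θ.toStage13Params P) → ∀ j, 1 ≤ j → j ≤ P.K →
      3 * side (F.P P.K).L θ.ν.M₁ j ≤ cubeSide (F.P P.K).L θ.ν.M₂ (RkOfRecord (F.P P.K).L θ.ν.r (gOfRecord₁₃ F N θ.toStage13Params P j)) j)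
    (hR : ∀ P : B12.RunParams, Step.InInterval γ P.K (gOfRecord₁₃ F N θ.toStage13Params P) → ∀ j, 1 ≤ j → j ≤ P.K →
      (F.P P.K).L ^ j + (((F.P P.K).d + 4) * (F.P P.K).L + 2) * (∑ l ∈ Finset.range j, (F.P P.K).L ^ l) + 2 ≤
        cubeSide (F.P P.K).L θ.ν.M₂ (RkOfRecord (F.P P.K).L θ.ν.r (gOfRecord₁₃ F N θ.toStage13Params P j)) j)
    (hε : ∀ P : B12.RunParams, Step.InInterval γ P.K (gOfRecord₁₃ F N θ.toStage13Params P) → ∀ j, 1 ≤ j → j ≤ P.K →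
      0 < epsOfRecord θ.ν (gOfRecord₁₃ F N θ.toStage13Params P) j)
    (hε3 : ∀ P : B12.RunParams, Step.InInterval γ P.K (gOfRecord₁₃ F N θ.toStage13Params P) → ∀ j, 1 ≤ j → j ≤ P.K →
      (143 * (((((F.P P.K).d + 4 : ℕ) : ℝ)) ^ 2 / 4) ^ 2) * epsOfRecord θ.ν (gOfRecord₁₃ F N θ.toStage13Params P) j ≤ 1 / 3)
    (hε2 : ∀ P : B12.RunParams, Step.InInterval γ P.K (gOfRecord₁₃ F N θ.toStage13Params P) → ∀ j, 1 ≤ j → j ≤ P.K →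
      2 * epsOfRecord θ.ν (gOfRecord₁₃ F N θ.toStage13Params P) j ≤ 2 * ExpMeanLog.deltaSU (Fin N) / ((((F.P P.K).d + 4) * (F.P P.K).L : ℕ) : ℝ) ^ 2)
    (hsolv : ∀ P : B12.RunParams, Step.InInterval γ P.K (gOfRecord₁₃ F N θ.toStage13Params P) → ∀ j, 1 ≤ j → j ≤ P.K →
      ∀ (s : SeqOfRecord F θ.ν θ.τ9.M (gOfRecord₁₃ F N θ.toStage13Params P) P.K j) (V : GaugeField (F.P P.K) j (SU N)),
      chiSeqOfRecord F N θ.ν θ.τ9.M (gOfRecord₁₃ F N θ.toStage13Params P) P.K j s V ≠ 0 →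
      ∀ a ∈ cubesIn (fun a : ↥(cubeIndices (F.P P.K) (cubeSide (F.P P.K).L θ.ν.M₂ (RkOfRecord (F.P P.K).L θ.ν.r (gOfRecord₁₃ F N θ.toStage13Params P j)) j)) =>
          cubeEnl (F.P P.K) (cubeSide (F.P P.K).L θ.ν.M₂ (RkOfRecord (F.P P.K).L θ.ν.r (gOfRecord₁₃ F N θ.toStage13Params P j)) j) a 0) (s.Ω j),
        ∃ U₀, IsMinimizer (avOfRecord F N P.K) {U | PlaqSmall (θ.ν.εreg * (F.P P.K).eta j ^ 2) U}
          (Bj θ.ν.M₁ (cubeEnl (F.P P.K) (cubeSide (F.P P.K).L θ.ν.M₂ (RkOfRecord (F.P P.K).L θ.ν.r (gOfRecord₁₃ F N θ.toStage13Params P j)) j) a 4) j)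
          (avgFamily (avOfRecord F N P.K) (qsstarGIter0 j V)) U₀)
    (σ : (P : B12.RunParams) → Sect3Supplier θ P)
    (hσ : ∀ P : B12.RunParams, Step.InInterval γ P.K (gOfRecord₁₃ F N θ.toStage13Params P) → SupplierObligations θ P (σ P))
    (hσB : ∀ P : B12.RunParams, Step.InInterval γ P.K (gOfRecord₁₃ F N θ.toStage13Params P) → SupplierBorel θ P (σ P))
    (w : WorldP) (hC : w.C = (datumOfRecord₁₃CoPH F N θ h).C) (hγw : w.γ ≤ min γ θ.γ) :
    ∀ P : B12.RunParams, Dag.B14_main (leavesP w P) := fun P =>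
  b14_main_leavesP_of_supplyChainAt_of_window h hsel hθ hκ hE₀ hB₀ ((Nat.succ_le_of_lt hM₁).trans hle) w hC fun hw =>
    have hW := step_inInterval_top_of_flow_inInterval_min θ h (B14Cor3.inInterval_of_le hw hγw)
    supplyChainAt_of_gaussCert_of_supplierBorel_of_bgFacts_of_powM θ P hζ hq h hθ hM₁ hle hcR hW.2 (hbgs P hW.1) hdiv hMa (h3 P hW.1) (hR P hW.1)
      (hε P hW.1) (hε3 P hW.1) (hε2 P hW.1) (hsolv P hW.1) (σ P) (hσ P hW.1) (hσB P hW.1)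

/-- **★★ THE THIRTEEN DAG NODES PASS TO EVERY CEILING ON THE SupplierBorel ∕ bg-FACTS ROAD** — nodes at a world `w` bound to the CoPH datum of a Gaussian-class `θ` with
`w.γ ≤ min γ θ.γ` + this road's rows ⇒ nodes at `withCeiling w c` for EVERY real `c` (upward included): dag-n11-d g14's ★★ `nodes_leavesP_withCeiling_of_supplyChainAt` with
its chain binder `hN` DISCHARGED here (of the thirteen mains only N11 reads `w.βup`, and on this road N11 does not read it; `withCeiling` keeps `C` and `γ`, `rfl`).
[cite: Balaban1989LargeFieldII, Introduction pp.355–356 (the citation DAG); Balaban1988Convergent, Thm 1 p.262, (2.6) p.255, (2.28) p.259, §3 p.279 (bookkeeping)] -/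
theorem nodes_leavesP_withCeiling_of_gaussCert_of_supplierBorel_of_bgFacts_of_powM
    (hζ : ∀ (p : B12.RunParams) (n : ℕ) (Ω Λ : ℕ → Set (Site (F.P p.K) 0)), (θ.Zh p n Ω Λ).ζ0 = (ZhPinOfRecord₁₃ θ.toStage13Params p Ω Λ).ζ0)
    (hq : ∀ (p : B12.RunParams) (n : ℕ) (Ω Λ : ℕ → Set (Site (F.P p.K) 0)) (j : ℕ) (Λ' : Set (Site (F.P p.K) 0)) (ω : MultiCfg (F.P p.K) (SU N) (FluctV N)),
      (θ.Zh p n Ω Λ).quad j Λ' ω = ∑ b ∈ (Set.toFinite (bondsIn j (Λ'ᶜ ∩ Ω (j + 1)))).toFinset, ‖(ω j).2 b‖ ^ 2)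
    (h : θ.Provisos₁₃CoPH F N) (hsel : θ.ppSel = ppSelLiveOfRecord F N θ.ν θ.τ9 (EOfRecord₁₃ F N θ.toStage13Params) (wOfRecord₉ F N θ.toStage9Params))
    (hθ : θ.Admissible F N) (hκ : 0 ≤ θ.s2.lf.κ) (hE₀ : 0 ≤ θ.s2.lf.E₀) (hB₀ : 0 ≤ θ.s2.lf.B₀)
    (hM₁ : 0 < θ.ν.M₁) (hle : θ.ν.M₁ ≤ θ.τ9.M) (hcR : 2 ≤ θ.s2.cR) {γ : ℝ}
    (hbgs : ∀ P : B12.RunParams, Step.InInterval γ P.K (gOfRecord₁₃ F N θ.toStage13Params P) → ∀ k, k ≤ P.K →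
      BgProvisoΛ F N P.K (settingOfRecord₁₃ F N θ.toStage13Params P) (θ.Rz P.K) θ.τ9.M k (suppOfRecord₁₃SepCoP F N θ.toStage13Params P k)
        (UbgOfRecord₁₃CoP F N θ.toStage13Params P k))
    (hdiv : F.L * θ.ν.M₂ ∣ θ.τ9.M) {a : ℕ} (hMa : θ.τ9.M = F.L ^ a)
    (h3 : ∀ P : B12.RunParams, Step.InInterval γ P.K (gOfRecord₁₃ F N θ.toStage13Params P) → ∀ j, 1 ≤ j → j ≤ P.K →
      3 * side (F.P P.K).L θ.ν.M₁ j ≤ cubeSide (F.P P.K).L θ.ν.M₂ (RkOfRecord (F.P P.K).L θ.ν.r (gOfRecord₁₃ F N θ.toStage13Params P j)) j)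
    (hR : ∀ P : B12.RunParams, Step.InInterval γ P.K (gOfRecord₁₃ F N θ.toStage13Params P) → ∀ j, 1 ≤ j → j ≤ P.K →
      (F.P P.K).L ^ j + (((F.P P.K).d + 4) * (F.P P.K).L + 2) * (∑ l ∈ Finset.range j, (F.P P.K).L ^ l) + 2 ≤
        cubeSide (F.P P.K).L θ.ν.M₂ (RkOfRecord (F.P P.K).L θ.ν.r (gOfRecord₁₃ F N θ.toStage13Params P j)) j)
    (hε : ∀ P : B12.RunParams, Step.InInterval γ P.K (gOfRecord₁₃ F N θ.toStage13Params P) → ∀ j, 1 ≤ j → j ≤ P.K →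
      0 < epsOfRecord θ.ν (gOfRecord₁₃ F N θ.toStage13Params P) j)
    (hε3 : ∀ P : B12.RunParams, Step.InInterval γ P.K (gOfRecord₁₃ F N θ.toStage13Params P) → ∀ j, 1 ≤ j → j ≤ P.K →
      (143 * (((((F.P P.K).d + 4 : ℕ) : ℝ)) ^ 2 / 4) ^ 2) * epsOfRecord θ.ν (gOfRecord₁₃ F N θ.toStage13Params P) j ≤ 1 / 3)
    (hε2 : ∀ P : B12.RunParams, Step.InInterval γ P.K (gOfRecord₁₃ F N θ.toStage13Params P) → ∀ j, 1 ≤ j → j ≤ P.K →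
      2 * epsOfRecord θ.ν (gOfRecord₁₃ F N θ.toStage13Params P) j ≤ 2 * ExpMeanLog.deltaSU (Fin N) / ((((F.P P.K).d + 4) * (F.P P.K).L : ℕ) : ℝ) ^ 2)
    (hsolv : ∀ P : B12.RunParams, Step.InInterval γ P.K (gOfRecord₁₃ F N θ.toStage13Params P) → ∀ j, 1 ≤ j → j ≤ P.K →
      ∀ (s : SeqOfRecord F θ.ν θ.τ9.M (gOfRecord₁₃ F N θ.toStage13Params P) P.K j) (V : GaugeField (F.P P.K) j (SU N)),
      chiSeqOfRecord F N θ.ν θ.τ9.M (gOfRecord₁₃ F N θ.toStage13Params P) P.K j s V ≠ 0 →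
      ∀ a ∈ cubesIn (fun a : ↥(cubeIndices (F.P P.K) (cubeSide (F.P P.K).L θ.ν.M₂ (RkOfRecord (F.P P.K).L θ.ν.r (gOfRecord₁₃ F N θ.toStage13Params P j)) j)) =>
          cubeEnl (F.P P.K) (cubeSide (F.P P.K).L θ.ν.M₂ (RkOfRecord (F.P P.K).L θ.ν.r (gOfRecord₁₃ F N θ.toStage13Params P j)) j) a 0) (s.Ω j),
        ∃ U₀, IsMinimizer (avOfRecord F N P.K) {U | PlaqSmall (θ.ν.εreg * (F.P P.K).eta j ^ 2) U}
          (Bj θ.ν.M₁ (cubeEnl (F.P P.K) (cubeSide (F.P P.K).L θ.ν.M₂ (RkOfRecord (F.P P.K).L θ.ν.r (gOfRecord₁₃ F N θ.toStage13Params P j)) j) a 4) j)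
          (avgFamily (avOfRecord F N P.K) (qsstarGIter0 j V)) U₀)
    (σ : (P : B12.RunParams) → Sect3Supplier θ P)
    (hσ : ∀ P : B12.RunParams, Step.InInterval γ P.K (gOfRecord₁₃ F N θ.toStage13Params P) → SupplierObligations θ P (σ P))
    (hσB : ∀ P : B12.RunParams, Step.InInterval γ P.K (gOfRecord₁₃ F N θ.toStage13Params P) → SupplierBorel θ P (σ P))
    (w : WorldP) (hC : w.C = (datumOfRecord₁₃CoPH F N θ h).C) (hγw : w.γ ≤ min γ θ.γ)
    (hn : ∀ P : B12.RunParams, Nodes (leavesP w P)) (c : ℝ) : ∀ P : B12.RunParams, Nodes (leavesP (withCeiling w c) P) := fun P =>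
  nodes_leavesP_withCeiling_of_b14_main w c P (hn P)
    (b14_main_leavesP_all_of_gaussCert_of_supplierBorel_of_bgFacts_of_powM θ hζ hq h hsel hθ hκ hE₀ hB₀ hM₁ hle hcR hbgs hdiv hMa h3 hR hε hε3 hε2 hsolv σ hσ hσB
      (withCeiling w c) hC hγw P)

end AllRuns

/-! ## §3  The `h11`-shaped (S1ᵀ) family of the K1-by-name road at the SepCoPH datum — a socket at any Gaussian-class `θ` on this road -/

section H11

variable (θ : Stage13HParams F N)

/-- **★★★ N11's CHILD FAMILY IN THE `h11` SHAPE OF THE K1⁹-BY-NAME ROAD (dag-n24-c `…K1R9ByName…`, binder `h11` VERBATIM up to the choice of `θ`), ON THE SupplierBorel ∕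
bg-FACTS ROAD**: for every `(βup, β₀)` SOME `γ₁₁ > 0` — here `γ₁₁ := min γ θ.γ`, uniformly in `(βup, β₀)` — such that at EVERY world `w` bound to the SepCoPH datum of `θ` with
`w.βup = βup`, `w.β₀ = β₀`, `w.γ ≤ γ₁₁`, for EVERY run, under the node's own leaf antecedents `b7 → b8 → b9 → b10 → b11 → smallCouplings → smallFieldInductive → flowControl`, the
(S1ᵀ) slot `∀ k < K, SLaw₁₃CoPH θ P k → TLaw₁₃CoPH θ P k` ([III]'s Theorem p. 245) holds — of the antecedents ONLY `smallCouplings` is read (it is the window of the record's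
couplings, `rfl`; the others, incl. (2.6) `flowControl` and the ceiling `βup`, are UNREAD on the chain road, dag-n11-d g14).  Rows as in §2 plus `0 < γ` (for `0 < γ₁₁`; `0 < θ.γ`
from admissibility); the (S1ᵀ) slot by dag-n11-e's `thmP245Laws_of_supplyChainAt` on H3's token.  A SOCKET: the road's rows are displayed at a general `θ` — at the witnesses of
record `2 ≤ cR` fails (`cR := 1`), at a cR-lettered member (dag-n11-w3 g4 ∕ dag-n11-w5 g2) they are the member files' business. [cite: Balaban1988Convergent, Theorem p.245, Thm 1 p.262, remark p.262, p.244 L36–38, §3 p.279, (2.6) p.255, (2.28) p.259, (3.24)–(3.25) p.270; Balaban1989LargeFieldII, Thm 1 + (0.1) pp.355–356; Balaban1989LargeFieldI, (0.3)–(0.4) p.176, p.177 (i)–(ii); Balaban1985Variational, Thm 1 (7)–(8) pp.278–279] -/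
theorem h11Family_of_gaussCert_of_supplierBorel_of_bgFacts_of_powM
    (hζ : ∀ (p : B12.RunParams) (n : ℕ) (Ω Λ : ℕ → Set (Site (F.P p.K) 0)), (θ.Zh p n Ω Λ).ζ0 = (ZhPinOfRecord₁₃ θ.toStage13Params p Ω Λ).ζ0)
    (hq : ∀ (p : B12.RunParams) (n : ℕ) (Ω Λ : ℕ → Set (Site (F.P p.K) 0)) (j : ℕ) (Λ' : Set (Site (F.P p.K) 0)) (ω : MultiCfg (F.P p.K) (SU N) (FluctV N)),
      (θ.Zh p n Ω Λ).quad j Λ' ω = ∑ b ∈ (Set.toFinite (bondsIn j (Λ'ᶜ ∩ Ω (j + 1)))).toFinset, ‖(ω j).2 b‖ ^ 2)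
    (h : θ.Provisos₁₃SepCoPH F N) (hsel : θ.ppSel = ppSelLiveOfRecord F N θ.ν θ.τ9 (EOfRecord₁₃ F N θ.toStage13Params) (wOfRecord₉ F N θ.toStage9Params))
    (hθ : θ.Admissible F N) (hκ : 0 ≤ θ.s2.lf.κ) (hE₀ : 0 ≤ θ.s2.lf.E₀) (hB₀ : 0 ≤ θ.s2.lf.B₀)
    (hM₁ : 0 < θ.ν.M₁) (hle : θ.ν.M₁ ≤ θ.τ9.M) (hcR : 2 ≤ θ.s2.cR) {γ : ℝ} (hγ : 0 < γ)
    (hbgs : ∀ P : B12.RunParams, Step.InInterval γ P.K (gOfRecord₁₃ F N θ.toStage13Params P) → ∀ k, k ≤ P.K →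
      BgProvisoΛ F N P.K (settingOfRecord₁₃ F N θ.toStage13Params P) (θ.Rz P.K) θ.τ9.M k (suppOfRecord₁₃SepCoP F N θ.toStage13Params P k)
        (UbgOfRecord₁₃CoP F N θ.toStage13Params P k))
    (hdiv : F.L * θ.ν.M₂ ∣ θ.τ9.M) {a : ℕ} (hMa : θ.τ9.M = F.L ^ a)
    (h3 : ∀ P : B12.RunParams, Step.InInterval γ P.K (gOfRecord₁₃ F N θ.toStage13Params P) → ∀ j, 1 ≤ j → j ≤ P.K →
      3 * side (F.P P.K).L θ.ν.M₁ j ≤ cubeSide (F.P P.K).L θ.ν.M₂ (RkOfRecord (F.P P.K).L θ.ν.r (gOfRecord₁₃ F N θ.toStage13Params P j)) j)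
    (hR : ∀ P : B12.RunParams, Step.InInterval γ P.K (gOfRecord₁₃ F N θ.toStage13Params P) → ∀ j, 1 ≤ j → j ≤ P.K →
      (F.P P.K).L ^ j + (((F.P P.K).d + 4) * (F.P P.K).L + 2) * (∑ l ∈ Finset.range j, (F.P P.K).L ^ l) + 2 ≤
        cubeSide (F.P P.K).L θ.ν.M₂ (RkOfRecord (F.P P.K).L θ.ν.r (gOfRecord₁₃ F N θ.toStage13Params P j)) j)
    (hε : ∀ P : B12.RunParams, Step.InInterval γ P.K (gOfRecord₁₃ F N θ.toStage13Params P) → ∀ j, 1 ≤ j → j ≤ P.K →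
      0 < epsOfRecord θ.ν (gOfRecord₁₃ F N θ.toStage13Params P) j)
    (hε3 : ∀ P : B12.RunParams, Step.InInterval γ P.K (gOfRecord₁₃ F N θ.toStage13Params P) → ∀ j, 1 ≤ j → j ≤ P.K →
      (143 * (((((F.P P.K).d + 4 : ℕ) : ℝ)) ^ 2 / 4) ^ 2) * epsOfRecord θ.ν (gOfRecord₁₃ F N θ.toStage13Params P) j ≤ 1 / 3)
    (hε2 : ∀ P : B12.RunParams, Step.InInterval γ P.K (gOfRecord₁₃ F N θ.toStage13Params P) → ∀ j, 1 ≤ j → j ≤ P.K →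
      2 * epsOfRecord θ.ν (gOfRecord₁₃ F N θ.toStage13Params P) j ≤ 2 * ExpMeanLog.deltaSU (Fin N) / ((((F.P P.K).d + 4) * (F.P P.K).L : ℕ) : ℝ) ^ 2)
    (hsolv : ∀ P : B12.RunParams, Step.InInterval γ P.K (gOfRecord₁₃ F N θ.toStage13Params P) → ∀ j, 1 ≤ j → j ≤ P.K →
      ∀ (s : SeqOfRecord F θ.ν θ.τ9.M (gOfRecord₁₃ F N θ.toStage13Params P) P.K j) (V : GaugeField (F.P P.K) j (SU N)),
      chiSeqOfRecord F N θ.ν θ.τ9.M (gOfRecord₁₃ F N θ.toStage13Params P) P.K j s V ≠ 0 →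
      ∀ a ∈ cubesIn (fun a : ↥(cubeIndices (F.P P.K) (cubeSide (F.P P.K).L θ.ν.M₂ (RkOfRecord (F.P P.K).L θ.ν.r (gOfRecord₁₃ F N θ.toStage13Params P j)) j)) =>
          cubeEnl (F.P P.K) (cubeSide (F.P P.K).L θ.ν.M₂ (RkOfRecord (F.P P.K).L θ.ν.r (gOfRecord₁₃ F N θ.toStage13Params P j)) j) a 0) (s.Ω j),
        ∃ U₀, IsMinimizer (avOfRecord F N P.K) {U | PlaqSmall (θ.ν.εreg * (F.P P.K).eta j ^ 2) U}
          (Bj θ.ν.M₁ (cubeEnl (F.P P.K) (cubeSide (F.P P.K).L θ.ν.M₂ (RkOfRecord (F.P P.K).L θ.ν.r (gOfRecord₁₃ F N θ.toStage13Params P j)) j) a 4) j)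
          (avgFamily (avOfRecord F N P.K) (qsstarGIter0 j V)) U₀)
    (σ : (P : B12.RunParams) → Sect3Supplier θ P)
    (hσ : ∀ P : B12.RunParams, Step.InInterval γ P.K (gOfRecord₁₃ F N θ.toStage13Params P) → SupplierObligations θ P (σ P))
    (hσB : ∀ P : B12.RunParams, Step.InInterval γ P.K (gOfRecord₁₃ F N θ.toStage13Params P) → SupplierBorel θ P (σ P)) :
    ∀ βup β₀ : ℝ, ∃ γ₁₁ : ℝ, 0 < γ₁₁ ∧ ∀ w : WorldP, w.C = (datumOfRecord₁₃SepCoPH F N θ h).C → w.βup = βup → w.β₀ = β₀ → w.γ ≤ γ₁₁ →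
      ∀ P : B12.RunParams, (leavesP w P).b7 → (leavesP w P).b8 → (leavesP w P).b9 → (leavesP w P).b10 → (leavesP w P).b11 →
      (leavesP w P).smallCouplings → (leavesP w P).smallFieldInductive → (leavesP w P).flowControl →
        ∀ k, k < P.K → SLaw₁₃CoPH F N θ P k → TLaw₁₃CoPH F N θ P k := fun _ _ =>
  ⟨min γ θ.γ, lt_min hγ hθ.toStage9.gamma_pos, fun w hC _ _ hγw P _ _ _ _ _ hsc _ _ =>
    have hsc' : ((datumOfRecord₁₃SepCoPH F N θ h).C P).flow.InInterval w.γ P.K := by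
      have h₀ : (w.C P).flow.InInterval w.γ P.K := hsc
      rwa [hC] at h₀
    have hW := step_inInterval_top_of_flow_inInterval_min θ h.toCore (B14Cor3.inInterval_of_le hsc' hγw)
    thmP245Laws_of_supplyChainAt h.toCore hsel hθ hκ hE₀ hB₀ ((Nat.succ_le_of_lt hM₁).trans hle)
      (supplyChainAt_of_gaussCert_of_supplierBorel_of_bgFacts_of_powM θ P hζ hq h.toCore hθ hM₁ hle hcR hW.2 (hbgs P hW.1) hdiv hMa (h3 P hW.1) (hR P hW.1)
        (hε P hW.1) (hε3 P hW.1) (hε2 P hW.1) (hsolv P hW.1) (σ P) (hσ P hW.1) (hσB P hW.1))⟩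

end H11

/-! ## §4  The editions at the NAMED Gaussian certificate `gaussPinH θ` — no class hypothesis -/

section Named

variable (θ : Stage13HParams F N)

/-- **★★ N11's DAG NODE AT EVERY RUN AT A WORLD BOUND TO THE K1-KEYED DATUM OF THE NAMED CERTIFICATE `gaussPinH θ`** (`datumOfRecord₁₃SepCoPH F N (gaussPinH θ)
(provisos₁₃SepCoPH_gaussPinH h)`; §2's node face with the class hypotheses discharged by `gaussPinH_ζ0 ∕ gaussPinH_quad` (`rfl`) and the key transferred by
`provisos₁₃SepCoPH_gaussPinH`; the rows, stated over `θ`'s Stage-13 letters, serve the certificate verbatim — it shares `θ.toStage13RParams`).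
[cite: Balaban1988Convergent, Thm 1 p.262, Theorem p.245, p.244 L36–38, §3 p.279, (2.28) p.259, (3.16) p.268, (3.24)–(3.25) p.270; Balaban1989LargeFieldII, Thm 1 + (0.1) pp.355–356; Balaban1989LargeFieldI, (0.3)–(0.4) p.176; Balaban1985Variational, Thm 1 (7)–(8) pp.278–279] -/
theorem b14_main_leavesP_all_gaussPinH_of_supplierBorel_of_bgFacts_of_powM
    (h : θ.Provisos₁₃SepCoPH F N) (hsel : θ.ppSel = ppSelLiveOfRecord F N θ.ν θ.τ9 (EOfRecord₁₃ F N θ.toStage13Params) (wOfRecord₉ F N θ.toStage9Params))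
    (hθ : θ.Admissible F N) (hκ : 0 ≤ θ.s2.lf.κ) (hE₀ : 0 ≤ θ.s2.lf.E₀) (hB₀ : 0 ≤ θ.s2.lf.B₀)
    (hM₁ : 0 < θ.ν.M₁) (hle : θ.ν.M₁ ≤ θ.τ9.M) (hcR : 2 ≤ θ.s2.cR) {γ : ℝ}
    (hbgs : ∀ P : B12.RunParams, Step.InInterval γ P.K (gOfRecord₁₃ F N θ.toStage13Params P) → ∀ k, k ≤ P.K →
      BgProvisoΛ F N P.K (settingOfRecord₁₃ F N θ.toStage13Params P) (θ.Rz P.K) θ.τ9.M k (suppOfRecord₁₃SepCoP F N θ.toStage13Params P k)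
        (UbgOfRecord₁₃CoP F N θ.toStage13Params P k))
    (hdiv : F.L * θ.ν.M₂ ∣ θ.τ9.M) {a : ℕ} (hMa : θ.τ9.M = F.L ^ a)
    (h3 : ∀ P : B12.RunParams, Step.InInterval γ P.K (gOfRecord₁₃ F N θ.toStage13Params P) → ∀ j, 1 ≤ j → j ≤ P.K →
      3 * side (F.P P.K).L θ.toStage13Params.ν.M₁ j ≤ cubeSide (F.P P.K).L θ.toStage13Params.ν.M₂ (RkOfRecord (F.P P.K).L θ.toStage13Params.ν.r (gOfRecord₁₃ F N θ.toStage13Params P j)) j)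
    (hR : ∀ P : B12.RunParams, Step.InInterval γ P.K (gOfRecord₁₃ F N θ.toStage13Params P) → ∀ j, 1 ≤ j → j ≤ P.K →
      (F.P P.K).L ^ j + (((F.P P.K).d + 4) * (F.P P.K).L + 2) * (∑ l ∈ Finset.range j, (F.P P.K).L ^ l) + 2 ≤
        cubeSide (F.P P.K).L θ.toStage13Params.ν.M₂ (RkOfRecord (F.P P.K).L θ.toStage13Params.ν.r (gOfRecord₁₃ F N θ.toStage13Params P j)) j)
    (hε : ∀ P : B12.RunParams, Step.InInterval γ P.K (gOfRecord₁₃ F N θ.toStage13Params P) → ∀ j, 1 ≤ j → j ≤ P.K →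
      0 < epsOfRecord θ.toStage13Params.ν (gOfRecord₁₃ F N θ.toStage13Params P) j)
    (hε3 : ∀ P : B12.RunParams, Step.InInterval γ P.K (gOfRecord₁₃ F N θ.toStage13Params P) → ∀ j, 1 ≤ j → j ≤ P.K →
      (143 * (((((F.P P.K).d + 4 : ℕ) : ℝ)) ^ 2 / 4) ^ 2) * epsOfRecord θ.toStage13Params.ν (gOfRecord₁₃ F N θ.toStage13Params P) j ≤ 1 / 3)
    (hε2 : ∀ P : B12.RunParams, Step.InInterval γ P.K (gOfRecord₁₃ F N θ.toStage13Params P) → ∀ j, 1 ≤ j → j ≤ P.K →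
      2 * epsOfRecord θ.toStage13Params.ν (gOfRecord₁₃ F N θ.toStage13Params P) j ≤ 2 * ExpMeanLog.deltaSU (Fin N) / ((((F.P P.K).d + 4) * (F.P P.K).L : ℕ) : ℝ) ^ 2)
    (hsolv : ∀ P : B12.RunParams, Step.InInterval γ P.K (gOfRecord₁₃ F N θ.toStage13Params P) → ∀ j, 1 ≤ j → j ≤ P.K →
      ∀ (s : SeqOfRecord F θ.toStage13Params.ν θ.toStage13Params.τ9.M (gOfRecord₁₃ F N θ.toStage13Params P) P.K j) (V : GaugeField (F.P P.K) j (SU N)),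
      chiSeqOfRecord F N θ.toStage13Params.ν θ.toStage13Params.τ9.M (gOfRecord₁₃ F N θ.toStage13Params P) P.K j s V ≠ 0 →
      ∀ a ∈ cubesIn (fun a : ↥(cubeIndices (F.P P.K) (cubeSide (F.P P.K).L θ.toStage13Params.ν.M₂ (RkOfRecord (F.P P.K).L θ.toStage13Params.ν.r (gOfRecord₁₃ F N θ.toStage13Params P j)) j)) =>
          cubeEnl (F.P P.K) (cubeSide (F.P P.K).L θ.toStage13Params.ν.M₂ (RkOfRecord (F.P P.K).L θ.toStage13Params.ν.r (gOfRecord₁₃ F N θ.toStage13Params P j)) j) a 0) (s.Ω j),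
        ∃ U₀, IsMinimizer (avOfRecord F N P.K) {U | PlaqSmall (θ.toStage13Params.ν.εreg * (F.P P.K).eta j ^ 2) U}
          (Bj θ.toStage13Params.ν.M₁ (cubeEnl (F.P P.K) (cubeSide (F.P P.K).L θ.toStage13Params.ν.M₂ (RkOfRecord (F.P P.K).L θ.toStage13Params.ν.r (gOfRecord₁₃ F N θ.toStage13Params P j)) j) a 4) j)
          (avgFamily (avOfRecord F N P.K) (qsstarGIter0 j V)) U₀)
    (σ : (P : B12.RunParams) → Sect3Supplier (gaussPinH θ) P)
    (hσ : ∀ P : B12.RunParams, Step.InInterval γ P.K (gOfRecord₁₃ F N θ.toStage13Params P) → SupplierObligations (gaussPinH θ) P (σ P))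
    (hσB : ∀ P : B12.RunParams, Step.InInterval γ P.K (gOfRecord₁₃ F N θ.toStage13Params P) → SupplierBorel (gaussPinH θ) P (σ P))
    (w : WorldP) (hC : w.C = (datumOfRecord₁₃SepCoPH F N (gaussPinH θ) (provisos₁₃SepCoPH_gaussPinH h)).C) (hγw : w.γ ≤ min γ θ.γ) :
    ∀ P : B12.RunParams, Dag.B14_main (leavesP w P) :=
  b14_main_leavesP_all_of_gaussCert_of_supplierBorel_of_bgFacts_of_powM (gaussPinH θ) (gaussPinH_ζ0 θ) (gaussPinH_quad θ) (provisos₁₃SepCoPH_gaussPinH h).toCore hsel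
    hθ hκ hE₀ hB₀ hM₁ hle hcR hbgs hdiv hMa h3 hR hε hε3 hε2 hsolv σ hσ hσB w hC hγw

/-- **★★★ THE `h11`-SHAPED (S1ᵀ) FAMILY AT THE K1-KEYED DATUM OF THE NAMED CERTIFICATE `gaussPinH θ`** — §3 with the class hypotheses discharged (`rfl`) and the key
transferred by `provisos₁₃SepCoPH_gaussPinH`; `γ₁₁ := min γ θ.γ`.  THE HONEST STATE of N11's K1-road child on the `SupplierBorel` road: every displayed binder is satisfiable in kind
(the bg family by dag-n11-w4 ∕ dag-n11-w5 at H-extensions of K1's witness; K0's solvability = K0⁷'s rows; `2 ≤ cR` at a cR-lettered member) EXCEPT [III] §3's supplier, which is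
Thm 2 proper (XL, nobody's theorem). [cite: Balaban1988Convergent, Theorem p.245, Thm 1 p.262, remark p.262, p.244 L36–38, §3 p.279, (2.28) p.259, (3.16) p.268, (3.24)–(3.25) p.270; Balaban1989LargeFieldII, Thm 1 + (0.1) pp.355–356; Balaban1989LargeFieldI, (0.3)–(0.4) p.176, p.177 (i)–(ii); Balaban1985Variational, Thm 1 (7)–(8) pp.278–279] -/
theorem h11Family_gaussPinH_of_supplierBorel_of_bgFacts_of_powM
    (h : θ.Provisos₁₃SepCoPH F N) (hsel : θ.ppSel = ppSelLiveOfRecord F N θ.ν θ.τ9 (EOfRecord₁₃ F N θ.toStage13Params) (wOfRecord₉ F N θ.toStage9Params))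
    (hθ : θ.Admissible F N) (hκ : 0 ≤ θ.s2.lf.κ) (hE₀ : 0 ≤ θ.s2.lf.E₀) (hB₀ : 0 ≤ θ.s2.lf.B₀)
    (hM₁ : 0 < θ.ν.M₁) (hle : θ.ν.M₁ ≤ θ.τ9.M) (hcR : 2 ≤ θ.s2.cR) {γ : ℝ} (hγ : 0 < γ)
    (hbgs : ∀ P : B12.RunParams, Step.InInterval γ P.K (gOfRecord₁₃ F N θ.toStage13Params P) → ∀ k, k ≤ P.K →
      BgProvisoΛ F N P.K (settingOfRecord₁₃ F N θ.toStage13Params P) (θ.Rz P.K) θ.τ9.M k (suppOfRecord₁₃SepCoP F N θ.toStage13Params P k)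
        (UbgOfRecord₁₃CoP F N θ.toStage13Params P k))
    (hdiv : F.L * θ.ν.M₂ ∣ θ.τ9.M) {a : ℕ} (hMa : θ.τ9.M = F.L ^ a)
    (h3 : ∀ P : B12.RunParams, Step.InInterval γ P.K (gOfRecord₁₃ F N θ.toStage13Params P) → ∀ j, 1 ≤ j → j ≤ P.K →
      3 * side (F.P P.K).L θ.toStage13Params.ν.M₁ j ≤ cubeSide (F.P P.K).L θ.toStage13Params.ν.M₂ (RkOfRecord (F.P P.K).L θ.toStage13Params.ν.r (gOfRecord₁₃ F N θ.toStage13Params P j)) j)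
    (hR : ∀ P : B12.RunParams, Step.InInterval γ P.K (gOfRecord₁₃ F N θ.toStage13Params P) → ∀ j, 1 ≤ j → j ≤ P.K →
      (F.P P.K).L ^ j + (((F.P P.K).d + 4) * (F.P P.K).L + 2) * (∑ l ∈ Finset.range j, (F.P P.K).L ^ l) + 2 ≤
        cubeSide (F.P P.K).L θ.toStage13Params.ν.M₂ (RkOfRecord (F.P P.K).L θ.toStage13Params.ν.r (gOfRecord₁₃ F N θ.toStage13Params P j)) j)
    (hε : ∀ P : B12.RunParams, Step.InInterval γ P.K (gOfRecord₁₃ F N θ.toStage13Params P) → ∀ j, 1 ≤ j → j ≤ P.K →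
      0 < epsOfRecord θ.toStage13Params.ν (gOfRecord₁₃ F N θ.toStage13Params P) j)
    (hε3 : ∀ P : B12.RunParams, Step.InInterval γ P.K (gOfRecord₁₃ F N θ.toStage13Params P) → ∀ j, 1 ≤ j → j ≤ P.K →
      (143 * (((((F.P P.K).d + 4 : ℕ) : ℝ)) ^ 2 / 4) ^ 2) * epsOfRecord θ.toStage13Params.ν (gOfRecord₁₃ F N θ.toStage13Params P) j ≤ 1 / 3)
    (hε2 : ∀ P : B12.RunParams, Step.InInterval γ P.K (gOfRecord₁₃ F N θ.toStage13Params P) → ∀ j, 1 ≤ j → j ≤ P.K →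
      2 * epsOfRecord θ.toStage13Params.ν (gOfRecord₁₃ F N θ.toStage13Params P) j ≤ 2 * ExpMeanLog.deltaSU (Fin N) / ((((F.P P.K).d + 4) * (F.P P.K).L : ℕ) : ℝ) ^ 2)
    (hsolv : ∀ P : B12.RunParams, Step.InInterval γ P.K (gOfRecord₁₃ F N θ.toStage13Params P) → ∀ j, 1 ≤ j → j ≤ P.K →
      ∀ (s : SeqOfRecord F θ.toStage13Params.ν θ.toStage13Params.τ9.M (gOfRecord₁₃ F N θ.toStage13Params P) P.K j) (V : GaugeField (F.P P.K) j (SU N)),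
      chiSeqOfRecord F N θ.toStage13Params.ν θ.toStage13Params.τ9.M (gOfRecord₁₃ F N θ.toStage13Params P) P.K j s V ≠ 0 →
      ∀ a ∈ cubesIn (fun a : ↥(cubeIndices (F.P P.K) (cubeSide (F.P P.K).L θ.toStage13Params.ν.M₂ (RkOfRecord (F.P P.K).L θ.toStage13Params.ν.r (gOfRecord₁₃ F N θ.toStage13Params P j)) j)) =>
          cubeEnl (F.P P.K) (cubeSide (F.P P.K).L θ.toStage13Params.ν.M₂ (RkOfRecord (F.P P.K).L θ.toStage13Params.ν.r (gOfRecord₁₃ F N θ.toStage13Params P j)) j) a 0) (s.Ω j),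
        ∃ U₀, IsMinimizer (avOfRecord F N P.K) {U | PlaqSmall (θ.toStage13Params.ν.εreg * (F.P P.K).eta j ^ 2) U}
          (Bj θ.toStage13Params.ν.M₁ (cubeEnl (F.P P.K) (cubeSide (F.P P.K).L θ.toStage13Params.ν.M₂ (RkOfRecord (F.P P.K).L θ.toStage13Params.ν.r (gOfRecord₁₃ F N θ.toStage13Params P j)) j) a 4) j)
          (avgFamily (avOfRecord F N P.K) (qsstarGIter0 j V)) U₀)
    (σ : (P : B12.RunParams) → Sect3Supplier (gaussPinH θ) P)
    (hσ : ∀ P : B12.RunParams, Step.InInterval γ P.K (gOfRecord₁₃ F N θ.toStage13Params P) → SupplierObligations (gaussPinH θ) P (σ P))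
    (hσB : ∀ P : B12.RunParams, Step.InInterval γ P.K (gOfRecord₁₃ F N θ.toStage13Params P) → SupplierBorel (gaussPinH θ) P (σ P)) :
    ∀ βup β₀ : ℝ, ∃ γ₁₁ : ℝ, 0 < γ₁₁ ∧ ∀ w : WorldP, w.C = (datumOfRecord₁₃SepCoPH F N (gaussPinH θ) (provisos₁₃SepCoPH_gaussPinH h)).C →
      w.βup = βup → w.β₀ = β₀ → w.γ ≤ γ₁₁ →
      ∀ P : B12.RunParams, (leavesP w P).b7 → (leavesP w P).b8 → (leavesP w P).b9 → (leavesP w P).b10 → (leavesP w P).b11 →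
      (leavesP w P).smallCouplings → (leavesP w P).smallFieldInductive → (leavesP w P).flowControl →
        ∀ k, k < P.K → SLaw₁₃CoPH F N (gaussPinH θ) P k → TLaw₁₃CoPH F N (gaussPinH θ) P k :=
  h11Family_of_gaussCert_of_supplierBorel_of_bgFacts_of_powM (gaussPinH θ) (gaussPinH_ζ0 θ) (gaussPinH_quad θ) (provisos₁₃SepCoPH_gaussPinH h) hsel
    hθ hκ hE₀ hB₀ hM₁ hle hcR hγ hbgs hdiv hMa h3 hR hε hε3 hε2 hsolv σ hσ hσB

end Named

end Summit.QuantumFields.YangMills.Theorems.BalabanUVNodesN11NodeFacesOfSupplierBorelOfBgFacts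

end
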